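import Literature.AlgebraicGeometry.Motives.GeneratedAbelianSubvariety
import HarnessLib

/-!
# Sum maps of a morphism into a group object (Serre's `f_n`, relative form) and their base change

Topic `Literature/AlgebraicGeometry/Motives`; field-free twin of `GeneratedAbelianSubvariety` §«sum maps»
and of `GeneratesBaseChange` §§1–2 (piece F1 of the III-0 road of the `hodgecm-mathlib` cell,
memo `ROAD-III0-albanese-baseChange.md`, SPEC `SPEC-III0-pieces.md` §F1).  PROOF FILE with data definitions (bodies, no `sorry`, no named
fact, D-0026 debt 0).

Serre, *Morphismes universels et variété d'Albanese*, no. 1, attaches to a morphism `f : V → A` into a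
(commutative) group variety the maps `f_n : V²ⁿ → A`,
`f_n(x₁, …, x_n, y₁, …, y_n) = f(x₁) + ⋯ + f(x_n) − f(y₁) − ⋯ − f(y_n)`; Lang, *Abelian Varieties* II §3
(p. 35) says `f` *generates* `A` when some `f_n` is surjective, «a property stable under extension of the
ground field».  The tree's `pmSum φ n` (`GeneratedAbelianSubvariety`) realises `f_n` for `φ : X → A.X`,
`A : AbelianVariety K` over a FIELD, and `GeneratesBaseChange` moves it along `Spec L → Spec K`.  The III-0
road needs the same maps for a morphism `Ψ : Y → 𝒜` into an ABELIAN SCHEME over an affine base `Spec T`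
and their base change along an ARBITRARY `S′ → S` (generic fibre `Spec ℂ → Spec T`, closed fibre
`Spec κ → Spec T`).  Since the recursion only uses the cartesian monoidal structure and the group law, this
file records it once for a morphism `φ : X ⟶ G` into ANY group object `G` of ANY cartesian monoidal
category `C`, and its transport under ANY monoidal functor `F : C ⥤ D`:

* §1 `diffGrp φ = φ(x) φ(y)⁻¹`, `pmPowObj X n = (X ⊗ X)^{⊗(n+1)}`, **`pmSumGrp φ n : pmPowObj X n ⟶ G`**
  (Serre's recursion `s₀ = d`, `s_{n+1}(z, w) = s_n(z) · d(w)`, verbatim the tree's `pmSum`); naturality in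
  the SOURCE (`pmPowObjMap g n ≫ pmSumGrp φ n = pmSumGrp (g ≫ φ) n`, `pmPowObjMap` = the `(g ⊗ g)`-powers,
  an isomorphism when `g` is) and in the TARGET along homomorphisms of group objects
  (`pmSumGrp_comp_hom : pmSumGrp (φ ≫ u) n = pmSumGrp φ n ≫ u`, `[IsMonHom u]`).
* §2 for a monoidal functor `F` between cartesian monoidal categories (`G ↦ F G` a group object by Mathlib
  `Functor.grpObjObj`, scoped instance `Obj`): the structure isomorphisms
  `pmPowObjIso F X n : F (pmPowObj X n) ≅ pmPowObj (F X) n` and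
  **`map_pmSumGrp : F.map (pmSumGrp φ n) = (pmPowObjIso F X n).hom ≫ pmSumGrp (F.map φ) n`** — the group law
  of `F G` is `F` of the group law (`Functor.map_mul`, `Functor.map_inv'`, `δ_fst`, `δ_snd`); port, line by
  line, of the private `bcFunctor_map_pmSum` of `GeneratesBaseChange`.
* §3 schemes: `F = Over.pullback f : Over S ⥤ Over S′` for ANY morphism of schemes `f : S′ ⟶ S` (Mathlib:
  cartesian monoidal `Over S`, `(Over.pullback f).Braided`); `((Over.pullback f).map g).left` is a base
  change of `g.left` (`isPullback_pullback_map_left`, Görtz–Wedhorn I Prop. 4.16), so surjectivity passes to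
  it (Prop. 4.32 (2)); **`pullback_map_pmSumGrp`**, and the two surjectivity statements the road consumes:
  `surjective_pullback_map_pmSumGrp_left_iff` (`s_n(f^*φ)` is surjective iff the base change of `s_n(φ)`
  is) and `surjective_pmSumGrp_pullback_left` (`s_n(f^*φ)` is surjective if `s_n(φ)` is).  The group law on
  `(Over.pullback f).obj G` is `Functor.grpObjObj`, i.e. BY `rfl` the one of
  `AbelianSchemes.AbelianScheme.baseChange` / `.fibre` and of `Motives.AbelianVariety.baseChange`.
* §4 field bridge (`K` a field, `A : AbelianVariety K`, `φ : X ⟶ A.X`): `diffGrp φ = diffOf φ` (`rfl`);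
  the identity-built isomorphism `pmPowObjIsoPmPow X n : pmPowObj X n ≅ pmPow X n` with
  `(pmPowObjIsoPmPow X n).hom ≫ pmSum φ n = pmSumGrp φ n` (two separately compiled structural recursions
  on `ℕ` are not definitionally equal at an open `n`, only at numerals — hence an isomorphism, not `rfl`);
  `surjective_pmSumGrp_left_iff`, **`generates_iff_exists_surjective_pmSumGrp`**
  (`Generates φ ↔ ∃ n, Surjective (pmSumGrp φ n).left`), and `generates_iso_hom_comp_iff`
  (generation is insensitive to an isomorphism of the source).

Mathlib searched and used: `CartesianMonoidalCategory`, `GrpObj`, `IsMonHom`, `Hom.group` (scoped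
`MonObj`), `MonObj.comp_mul/mul_comp`, `GrpObj.comp_inv/inv_comp`, `tensorHom_fst/snd`, `lift_fst/snd`,
`lift_map`, `lift_fst_snd`, `Functor.Monoidal.μIso`, `Functor.OplaxMonoidal.δ_fst/δ_snd`,
`Functor.map_mul`, `Functor.map_inv'`, `Functor.grpObjObj` (scoped `Obj`), `Over.pullback` (+ its
`Braided` structure, `Mathlib.CategoryTheory.Monoidal.Cartesian.Over`), `IsPullback.of_right/of_hasPullback`,
`MorphismProperty.of_isPullback`, `MorphismProperty.cancel_left_of_respectsIso`, the instances
`IsStableUnderBaseChange @Surjective`, `RespectsIso @Surjective`, `tensor_isIso`.  Mathlib has no sum maps /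
generated subgroup schemes.

## References

* [Serre1958MorphismesUniversels] J.-P. Serre, *Morphismes universels et variété d'Albanese*,
  Sém. Chevalley 4 (1958/59), exp. 10, no. 1 (Déf. 1, the maps `f_n`).
* [Lang1983AbelianVarieties] S. Lang, *Abelian Varieties* (1959/1983), II §3 (p. 35).
* [GortzWedhorn2020] U. Görtz, T. Wedhorn, *Algebraic Geometry I*, 2nd ed. (2020): Section (4.7) (base change
  functor), Prop. 4.16 (transitivity of fibre products), Prop. 4.32 (2) (surjective morphisms are stable under
  base change), Remark 16.54 (base change of group schemes).
-/

noncomputable section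

universe v v₂ u u₂

open CategoryTheory CategoryTheory.Limits AlgebraicGeometry MonoidalCategory CartesianMonoidalCategory

namespace Literature.AlgebraicGeometry.Motives

open scoped MonObj Obj

/-! ### §1 Sum maps of a morphism into a group object of a cartesian monoidal category -/

section General

variable {C : Type u} [Category.{v} C] [CartesianMonoidalCategory C]

section Defs

variable {X G : C} [GrpObj G] (φ : X ⟶ G)

/-- The **difference map** `d(x, y) = φ(x) φ(y)⁻¹ : X ⊗ X ⟶ G` of a morphism `φ : X ⟶ G` into a group
object (points written multiplicatively); the tree's `diffOf` for an arbitrary group object.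
[cite: Serre1958MorphismesUniversels, no. 1] -/
def diffGrp : X ⊗ X ⟶ G := (fst X X ≫ φ) * (snd X X ≫ φ)⁻¹

variable (X) in
/-- The objects `X_n = (X ⊗ X)^{⊗(n+1)}`, sources of the sum maps (reducible, so that `X_{n+1}` is
syntactically `X_n ⊗ (X ⊗ X)`); the tree's `pmPow` for an arbitrary cartesian monoidal category.
[cite: Serre1958MorphismesUniversels, no. 1] -/
@[reducible]
def pmPowObj : ℕ → C
  | 0 => X ⊗ X
  | n + 1 => pmPowObj n ⊗ (X ⊗ X)

/-- **Serre's sum maps** `s_n : (X ⊗ X)^{⊗(n+1)} ⟶ G` of a morphism `φ : X ⟶ G` into a group object,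
`s_n((x₀, y₀), …, (x_n, y_n)) = ∏ᵢ φ(xᵢ) φ(yᵢ)⁻¹` accumulated by the recursion `s₀ = d`,
`s_{n+1}(z, w) = s_n(z) · d(w)` («`f_n(x₁, …, x_n, y₁, …, y_n) = f(x₁) + ⋯ + f(x_n) − f(y₁) − ⋯ − f(y_n)`»);
the tree's `pmSum` for an arbitrary group object (e.g. an abelian scheme over a ring).
[cite: Serre1958MorphismesUniversels, no. 1] -/
def pmSumGrp : (n : ℕ) → (pmPowObj X n ⟶ G)
  | 0 => diffGrp φ
  | n + 1 => (fst (pmPowObj X n) (X ⊗ X) ≫ pmSumGrp n) * (snd (pmPowObj X n) (X ⊗ X) ≫ diffGrp φ)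

/-- `s₀ = d`. [cite: Serre1958MorphismesUniversels, no. 1] -/
theorem pmSumGrp_zero : pmSumGrp φ 0 = diffGrp φ := rfl

/-- `s_{n+1}(z, w) = s_n(z) · d(w)`. [cite: Serre1958MorphismesUniversels, no. 1] -/
theorem pmSumGrp_succ (n : ℕ) :
    pmSumGrp φ (n + 1) =
      (fst (pmPowObj X n) (X ⊗ X) ≫ pmSumGrp φ n) * (snd (pmPowObj X n) (X ⊗ X) ≫ diffGrp φ) := rfl

/-- `(f ⊗ g) ≫ μ = (fst ≫ f) · (snd ≫ g)` for morphisms into a group (monoid) object.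
[cite: GortzWedhorn2020, Remark 16.54] -/
theorem tensorHom_mu_eq_mul {W W' : C} (f : W ⟶ G) (g : W' ⟶ G) :
    (f ⊗ₘ g) ≫ μ[G] = (fst W W' ≫ f) * (snd W W' ≫ g) := by
  rw [CategoryTheory.Hom.mul_def, ← lift_map, lift_fst_snd, Category.id_comp]

/-- `s_{n+1} = (s_n ⊗ d) ≫ μ`. [cite: Serre1958MorphismesUniversels, no. 1] -/
theorem pmSumGrp_succ_eq_tensorHom (n : ℕ) :
    pmSumGrp φ (n + 1) = (pmSumGrp φ n ⊗ₘ diffGrp φ) ≫ μ[G] := by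
  rw [tensorHom_mu_eq_mul]; rfl

/-- `⟨f, g⟩ ≫ d = (f ≫ φ) (g ≫ φ)⁻¹`. [cite: Serre1958MorphismesUniversels, no. 1] -/
theorem lift_diffGrp {W : C} (f g : W ⟶ X) : lift f g ≫ diffGrp φ = (f ≫ φ) * (g ≫ φ)⁻¹ := by
  rw [diffGrp, MonObj.comp_mul, GrpObj.comp_inv, lift_fst_assoc, lift_snd_assoc]

/-- `d(x, x) = 1`. [cite: Serre1958MorphismesUniversels, no. 1] -/
theorem lift_self_diffGrp {W : C} (f : W ⟶ X) : lift f f ≫ diffGrp φ = 1 := by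
  rw [lift_diffGrp, mul_inv_cancel]

end Defs

/-! #### Naturality in the source: precomposition with `g : X′ ⟶ X` -/

section Source

variable {X' X G : C} [GrpObj G] (φ : X ⟶ G) (g : X' ⟶ X)

/-- The maps `(g ⊗ g)^{⊗(n+1)} : X′_n ⟶ X_n` induced on the sources of the sum maps by `g : X′ ⟶ X`.
[cite: GortzWedhorn2020, Section (4.7)] -/
def pmPowObjMap : (n : ℕ) → (pmPowObj X' n ⟶ pmPowObj X n)
  | 0 => g ⊗ₘ g
  | n + 1 => pmPowObjMap n ⊗ₘ (g ⊗ₘ g)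

/-- `(g ⊗ g) ≫ d_φ = d_{g ≫ φ}`. [cite: Serre1958MorphismesUniversels, no. 1] -/
theorem tensorHom_comp_diffGrp : (g ⊗ₘ g) ≫ diffGrp φ = diffGrp (g ≫ φ) := by
  rw [diffGrp, diffGrp, MonObj.comp_mul, GrpObj.comp_inv, tensorHom_fst_assoc, tensorHom_snd_assoc]

/-- **The sum maps are natural in the source**: `(g ⊗ g)^{⊗(n+1)} ≫ s_n(φ) = s_n(g ≫ φ)`.
[cite: Serre1958MorphismesUniversels, no. 1] -/
theorem pmPowObjMap_comp_pmSumGrp : ∀ n, pmPowObjMap g n ≫ pmSumGrp φ n = pmSumGrp (g ≫ φ) n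
  | 0 => tensorHom_comp_diffGrp φ g
  | n + 1 => by
    change (pmPowObjMap g n ⊗ₘ (g ⊗ₘ g)) ≫ ((fst _ _ ≫ pmSumGrp φ n) * (snd _ _ ≫ diffGrp φ)) =
      (fst _ _ ≫ pmSumGrp (g ≫ φ) n) * (snd _ _ ≫ diffGrp (g ≫ φ))
    rw [MonObj.comp_mul, tensorHom_fst_assoc, tensorHom_snd_assoc, pmPowObjMap_comp_pmSumGrp n,
      tensorHom_comp_diffGrp]

/-- `(g ⊗ g)^{⊗(n+1)}` is an isomorphism when `g` is. [cite: GortzWedhorn2020, Section (4.7)] -/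
theorem isIso_pmPowObjMap [IsIso g] : ∀ n, IsIso (pmPowObjMap g n)
  | 0 => MonoidalCategory.tensor_isIso g g
  | n + 1 => by
    haveI := isIso_pmPowObjMap n
    exact MonoidalCategory.tensor_isIso _ _

/-- The isomorphisms `(i ⊗ i)^{⊗(n+1)} : X′_n ≅ X_n` induced by an isomorphism `i : X′ ≅ X` of the sources.
[cite: GortzWedhorn2020, Section (4.7)] -/
def pmPowObjMapIso (i : X' ≅ X) : (n : ℕ) → (pmPowObj X' n ≅ pmPowObj X n)
  | 0 => i ⊗ᵢ i
  | n + 1 => pmPowObjMapIso i n ⊗ᵢ (i ⊗ᵢ i)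

/-- The underlying morphism of `(i ⊗ i)^{⊗(n+1)}` is `pmPowObjMap i.hom n`. [cite: GortzWedhorn2020, Section (4.7)] -/
theorem pmPowObjMapIso_hom (i : X' ≅ X) : ∀ n, (pmPowObjMapIso i n).hom = pmPowObjMap i.hom n
  | 0 => rfl
  | n + 1 => by
    change (pmPowObjMapIso i n).hom ⊗ₘ (i.hom ⊗ₘ i.hom) = pmPowObjMap i.hom n ⊗ₘ (i.hom ⊗ₘ i.hom)
    rw [pmPowObjMapIso_hom i n]

/-- **Sum maps after an isomorphism of the source**: `s_n(i ≫ φ) = (i ⊗ i)^{⊗(n+1)} ≫ s_n(φ)` (the SPEC form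
consumed by the III-0 assembly, where the spread morphism recovers the complex Abel–Jacobi map only up to a
canonical isomorphism of the source). [cite: Serre1958MorphismesUniversels, no. 1] -/
theorem pmSumGrp_iso_hom_comp (i : X' ≅ X) (n : ℕ) :
    pmSumGrp (i.hom ≫ φ) n = (pmPowObjMapIso i n).hom ≫ pmSumGrp φ n := by
  rw [pmPowObjMapIso_hom, pmPowObjMap_comp_pmSumGrp]

end Source

/-! #### Naturality in the target: homomorphisms of group objects `u : G ⟶ H` -/

section Target

variable {X G H : C} [GrpObj G] [GrpObj H] (φ : X ⟶ G) (u : G ⟶ H) [IsMonHom u]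

/-- The difference map is natural in homomorphisms: `d_{φ ≫ u} = d_φ ≫ u`.
[cite: Serre1958MorphismesUniversels, no. 1] -/
theorem diffGrp_comp_hom : diffGrp (φ ≫ u) = diffGrp φ ≫ u := by
  rw [diffGrp, diffGrp, MonObj.mul_comp, GrpObj.inv_comp, Category.assoc, Category.assoc]

/-- **The sum maps are natural in homomorphisms of group objects**: `s_n(φ ≫ u) = s_n(φ) ≫ u`.
[cite: Serre1958MorphismesUniversels, no. 1] -/
theorem pmSumGrp_comp_hom : ∀ n, pmSumGrp (φ ≫ u) n = pmSumGrp φ n ≫ u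
  | 0 => diffGrp_comp_hom φ u
  | n + 1 => by
    change (fst _ _ ≫ pmSumGrp (φ ≫ u) n) * (snd _ _ ≫ diffGrp (φ ≫ u)) =
      ((fst _ _ ≫ pmSumGrp φ n) * (snd _ _ ≫ diffGrp φ)) ≫ u
    rw [pmSumGrp_comp_hom n, diffGrp_comp_hom, MonObj.mul_comp, Category.assoc, Category.assoc]

end Target

end General

/-! ### §2 Transport along a monoidal functor between cartesian monoidal categories -/

section Functor

variable {C : Type u} [Category.{v} C] [CartesianMonoidalCategory C]
  {D : Type u₂} [Category.{v₂} D] [CartesianMonoidalCategory D] (F : C ⥤ D) [F.Monoidal]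

section Iso

variable (X : C)

/-- The monoidal structure isomorphisms `F((X ⊗ X)^{⊗(n+1)}) ≅ (F X ⊗ F X)^{⊗(n+1)}` of `F`, along the
recursion `X_{n+1} = X_n ⊗ (X ⊗ X)` (the public, field-free form of `GeneratesBaseChange`'s
`pmPowBaseChangeIso`). [cite: GortzWedhorn2020, Section (4.7)] -/
def pmPowObjIso : (n : ℕ) → (F.obj (pmPowObj X n) ≅ pmPowObj (F.obj X) n)
  | 0 => (Functor.Monoidal.μIso F X X).symm
  | n + 1 => (Functor.Monoidal.μIso F (pmPowObj X n) (X ⊗ X)).symm ≪≫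
      (pmPowObjIso n ⊗ᵢ (Functor.Monoidal.μIso F X X).symm)

/-- In degree `0` the isomorphism is the oplax structure map `δ : F(X ⊗ X) ⟶ F X ⊗ F X`.
[cite: GortzWedhorn2020, Section (4.7)] -/
theorem pmPowObjIso_zero_hom : (pmPowObjIso F X 0).hom = Functor.OplaxMonoidal.δ F X X := rfl

/-- `e₀ ≫ pr₁ = F(pr₁)`. [cite: GortzWedhorn2020, Section (4.7)] -/
@[reassoc]
theorem pmPowObjIso_zero_hom_fst : (pmPowObjIso F X 0).hom ≫ fst _ _ = F.map (fst X X) := by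
  rw [pmPowObjIso_zero_hom, Functor.OplaxMonoidal.δ_fst]

/-- `e₀ ≫ pr₂ = F(pr₂)`. [cite: GortzWedhorn2020, Section (4.7)] -/
@[reassoc]
theorem pmPowObjIso_zero_hom_snd : (pmPowObjIso F X 0).hom ≫ snd _ _ = F.map (snd X X) := by
  rw [pmPowObjIso_zero_hom, Functor.OplaxMonoidal.δ_snd]

/-- `e_{n+1} ≫ pr₁ = F(pr₁) ≫ e_n`. [cite: GortzWedhorn2020, Section (4.7)] -/
@[reassoc]
theorem pmPowObjIso_succ_hom_fst (n : ℕ) :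
    (pmPowObjIso F X (n + 1)).hom ≫ fst _ _ =
      F.map (fst (pmPowObj X n) (X ⊗ X)) ≫ (pmPowObjIso F X n).hom := by
  change ((Functor.Monoidal.μIso F (pmPowObj X n) (X ⊗ X)).inv ≫
    ((pmPowObjIso F X n).hom ⊗ₘ (Functor.Monoidal.μIso F X X).inv)) ≫ fst _ _ = _
  rw [Category.assoc, tensorHom_fst, Functor.Monoidal.μIso_inv, Functor.OplaxMonoidal.δ_fst_assoc]

/-- `e_{n+1} ≫ pr₂ = F(pr₂) ≫ e₀`. [cite: GortzWedhorn2020, Section (4.7)] -/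
@[reassoc]
theorem pmPowObjIso_succ_hom_snd (n : ℕ) :
    (pmPowObjIso F X (n + 1)).hom ≫ snd _ _ =
      F.map (snd (pmPowObj X n) (X ⊗ X)) ≫ (pmPowObjIso F X 0).hom := by
  change ((Functor.Monoidal.μIso F (pmPowObj X n) (X ⊗ X)).inv ≫
    ((pmPowObjIso F X n).hom ⊗ₘ (Functor.Monoidal.μIso F X X).inv)) ≫ snd _ _ = _
  rw [Category.assoc, tensorHom_snd, Functor.Monoidal.μIso_inv, Functor.OplaxMonoidal.δ_snd_assoc]
  rfl

end Iso

variable {X G : C} [GrpObj G] (φ : X ⟶ G)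

/-- **`F` of the difference map**: `F(d_φ) = e₀ ≫ d_{F φ}`, i.e. `F(φ(x) φ(y)⁻¹) = Fφ(x) Fφ(y)⁻¹` on
`F(X ⊗ X) ≅ F X ⊗ F X` — the group law of `F G` is `F` of the group law (`Functor.grpObjObj`).
[cite: GortzWedhorn2020, Remark 16.54] -/
theorem map_diffGrp : F.map (diffGrp φ) = (pmPowObjIso F X 0).hom ≫ diffGrp (F.map φ) := by
  unfold diffGrp
  rw [MonObj.comp_mul, GrpObj.comp_inv, pmPowObjIso_zero_hom_fst_assoc, pmPowObjIso_zero_hom_snd_assoc,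
    ← Functor.map_comp, ← Functor.map_comp, Functor.map_mul, Functor.map_inv']

/-- **`F` of the sum maps**: `F(s_n(φ)) = e_n ≫ s_n(F φ)` for every `n` (induction along
`s_{n+1}(z, w) = s_n(z) · d(w)`); field-free form of `GeneratesBaseChange`'s `bcFunctor_map_pmSum`.
[cite: Serre1958MorphismesUniversels, no. 1] [cite: GortzWedhorn2020, Remark 16.54] -/
theorem map_pmSumGrp : ∀ n : ℕ,
    F.map (pmSumGrp φ n) = (pmPowObjIso F X n).hom ≫ pmSumGrp (F.map φ) n
  | 0 => map_diffGrp F φ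
  | n + 1 => by
    rw [pmSumGrp_succ, pmSumGrp_succ, MonObj.comp_mul, pmPowObjIso_succ_hom_fst_assoc,
      pmPowObjIso_succ_hom_snd_assoc, ← map_pmSumGrp n, ← map_diffGrp, ← Functor.map_comp,
      ← Functor.map_comp, Functor.map_mul]

/-- The sum maps of `F φ` are `F` of those of `φ`, up to the structure isomorphism.
[cite: Serre1958MorphismesUniversels, no. 1] [cite: GortzWedhorn2020, Remark 16.54] -/
theorem pmSumGrp_map (n : ℕ) :
    pmSumGrp (F.map φ) n = (pmPowObjIso F X n).inv ≫ F.map (pmSumGrp φ n) := by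
  rw [map_pmSumGrp, Iso.inv_hom_id_assoc]

end Functor

/-! ### §3 Schemes: base change `Over.pullback f : Over S ⥤ Over S′` along any `f : S′ ⟶ S` -/

section Schemes

variable {S S' : Scheme.{u}} (f : S' ⟶ S)

section IsPullback

variable {X Y : Over S} (g : X ⟶ Y)

/-- `f^*g` commutes with the first projections: `f^*g ≫ pr_Y = pr_X ≫ g`.
[cite: GortzWedhorn2020, Section (4.7)] -/
@[reassoc]
theorem pullback_map_left_comp_fst :
    ((Over.pullback f).map g).left ≫ pullback.fst Y.hom f = pullback.fst X.hom f ≫ g.left :=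
  pullback.lift_fst _ _ _

/-- `f^*g` is a morphism over `S′`. [cite: GortzWedhorn2020, Section (4.7)] -/
@[reassoc]
theorem pullback_map_left_comp_snd :
    ((Over.pullback f).map g).left ≫ pullback.snd Y.hom f = pullback.snd X.hom f :=
  pullback.lift_snd _ _ _

/-- **`f^*g : X ×_S S′ → Y ×_S S′` is a base change of `g`**: the square over `g.left` with the first
projections is cartesian (pasting of the two cartesian squares defining `X ×_S S′`, `Y ×_S S′`;
transitivity of fibre products).  Base-free form of `GeneratesBaseChange`'s private
`isPullback_bcFunctor_map_left`. [cite: GortzWedhorn2020, Prop. 4.16] -/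
theorem isPullback_pullback_map_left :
    IsPullback ((Over.pullback f).map g).left (pullback.fst X.hom f) (pullback.fst Y.hom f) g.left := by
  refine IsPullback.of_right ?_ (pullback_map_left_comp_fst f g) (IsPullback.of_hasPullback Y.hom f).flip
  rw [pullback_map_left_comp_snd, Over.w g]
  exact (IsPullback.of_hasPullback X.hom f).flip

/-- **Surjective morphisms stay surjective after any base change `S′ → S`**
(Mathlib `IsStableUnderBaseChange @Surjective`). [cite: GortzWedhorn2020, Prop. 4.32 (2)] -/
theorem surjective_pullback_map_left [Surjective g.left] : Surjective ((Over.pullback f).map g).left :=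
  MorphismProperty.of_isPullback (P := @Surjective) (isPullback_pullback_map_left f g).flip ‹_›

/-- Surjectivity of the underlying morphism of schemes is insensitive to an isomorphism of `S`-schemes on
the left. [cite: GortzWedhorn2020, Prop. 4.32 (2)] -/
theorem surjective_iso_hom_comp_left_iff {X Y Z : Over S} (e : X ≅ Y) (s : Y ⟶ Z) :
    Surjective (e.hom ≫ s).left ↔ Surjective s.left := by
  haveI : IsIso e.hom.left := ((Over.forget S).mapIso e).isIso_hom
  rw [Over.comp_left]
  exact MorphismProperty.cancel_left_of_respectsIso (P := @Surjective) e.hom.left s.left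

end IsPullback

variable {X G : Over S} [GrpObj G] (φ : X ⟶ G)

/-- **Base change of the relative sum maps**: for a morphism `φ : X ⟶ G` into an `S`-group scheme and any
`f : S′ ⟶ S`, `f^*(s_n(φ)) = e_n ≫ s_n(f^*φ)`, where `f^*G = G ×_S S′` carries the base-changed group law
(Mathlib `Functor.grpObjObj` — by `rfl` the group law of `AbelianScheme.baseChange`/`fibre` and of
`AbelianVariety.baseChange`) and `e_n : ((X ⊗ X)^{⊗(n+1)}) ×_S S′ ≅ (f^*X ⊗ f^*X)^{⊗(n+1)}` is the
monoidal structure isomorphism of `Over.pullback f`.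
[cite: Serre1958MorphismesUniversels, no. 1] [cite: GortzWedhorn2020, Remark 16.54] -/
theorem pullback_map_pmSumGrp (n : ℕ) :
    (Over.pullback f).map (pmSumGrp φ n) =
      (pmPowObjIso (Over.pullback f) X n).hom ≫ pmSumGrp ((Over.pullback f).map φ) n :=
  map_pmSumGrp (Over.pullback f) φ n

/-- **`s_n(f^*φ)` is surjective iff the base change of `s_n(φ)` is** (they differ by the structure
isomorphism `e_n`; the SPEC orientation of the III-0 assembly). [cite: GortzWedhorn2020, Prop. 4.32 (2)] -/
theorem surjective_pullback_map_pmSumGrp_left_iff (n : ℕ) :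
    Surjective (pmSumGrp ((Over.pullback f).map φ) n).left ↔
      Surjective ((Over.pullback f).map (pmSumGrp φ n)).left := by
  rw [pullback_map_pmSumGrp]
  exact (surjective_iso_hom_comp_left_iff _ _).symm

/-- **`s_n(f^*φ)` is surjective if `s_n(φ)` is**: Serre's `f_n` for `f^*φ : X ×_S S′ → G ×_S S′` is the
base change of `f_n` for `φ` up to `e_n`, and surjectivity is stable under base change.
[cite: Serre1958MorphismesUniversels, no. 1] [cite: GortzWedhorn2020, Prop. 4.32 (2)] -/
theorem surjective_pmSumGrp_pullback_left (n : ℕ) [Surjective (pmSumGrp φ n).left] :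
    Surjective (pmSumGrp ((Over.pullback f).map φ) n).left :=
  (surjective_pullback_map_pmSumGrp_left_iff f φ n).2 (surjective_pullback_map_left f _)

end Schemes

/-! ### §4 Over a field: comparison with `pmSum` / `Generates` of `GeneratedAbelianSubvariety` -/

section Field

variable {K : Type u} [Field K] {X : SchemeOver K} {A : AbelianVariety K} (φ : X ⟶ A.X)

/-- Over a field and for an abelian variety `A`, `diffGrp φ` IS the tree's `diffOf φ` (by `rfl`).
[cite: Serre1958MorphismesUniversels, no. 1] -/
theorem diffGrp_eq_diffOf : diffGrp φ = diffOf φ := rfl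

variable (X) in
/-- `pmPowObj X n = pmPow X n` as objects (the same recursion; PROPOSITIONAL only — the two compiled structural
recursions are not definitionally equal at an open `n`; use the isomorphism `pmPowObjIsoPmPow` to move
morphisms, never `eqToHom`/`cast` along this equation). [cite: Serre1958MorphismesUniversels, no. 1] -/
theorem pmPowObj_eq_pmPow : ∀ n : ℕ, pmPowObj X n = pmPow X n
  | 0 => rfl
  | n + 1 => by rw [pmPowObj, pmPow, pmPowObj_eq_pmPow n]

variable (X) in
/-- The identity-built isomorphism `pmPowObj X n ≅ pmPow X n` (`Iso.refl` in degree `0`,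
`· ⊗ Iso.refl (X ⊗ X)` along the common recursion): the two structural recursions agree at every numeral
but are not definitionally equal at an open `n`. [cite: Serre1958MorphismesUniversels, no. 1] -/
def pmPowObjIsoPmPow : (n : ℕ) → (pmPowObj X n ≅ pmPow X n)
  | 0 => Iso.refl _
  | n + 1 => pmPowObjIsoPmPow n ⊗ᵢ Iso.refl (X ⊗ X)

/-- **`pmSumGrp` IS `pmSum` over a field**, through the identity-built isomorphism of the sources:
`(pmPowObjIsoPmPow X n).hom ≫ pmSum φ n = pmSumGrp φ n`. [cite: Serre1958MorphismesUniversels, no. 1] -/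
theorem pmPowObjIsoPmPow_hom_comp_pmSum : ∀ n, (pmPowObjIsoPmPow X n).hom ≫ pmSum φ n = pmSumGrp φ n
  | 0 => by
    change 𝟙 _ ≫ diffOf φ = diffGrp φ
    rw [Category.id_comp]
    rfl
  | n + 1 => by
    change ((pmPowObjIsoPmPow X n).hom ⊗ₘ 𝟙 (X ⊗ X)) ≫ ((fst _ _ ≫ pmSum φ n) * (snd _ _ ≫ diffOf φ)) =
      (fst _ _ ≫ pmSumGrp φ n) * (snd _ _ ≫ diffGrp φ)
    rw [MonObj.comp_mul, tensorHom_fst_assoc, tensorHom_snd_assoc, pmPowObjIsoPmPow_hom_comp_pmSum n,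
      Category.id_comp]
    rfl

/-- Over a field, `s_n` in the sense of `pmSumGrp` is surjective iff the tree's `pmSum φ n` is.
[cite: Serre1958MorphismesUniversels, no. 1 Déf. 1] -/
theorem surjective_pmSumGrp_left_iff (n : ℕ) :
    Surjective (pmSumGrp φ n).left ↔ Surjective (pmSum φ n).left := by
  rw [← pmPowObjIsoPmPow_hom_comp_pmSum]
  exact surjective_iso_hom_comp_left_iff _ _

/-- **`φ` generates `A` iff some `pmSumGrp φ n` is surjective** — the tree's `Generates φ`
(`∃ n, Surjective (pmSum φ n).left`; Lang II §3, Serre Déf. 1) read through the generic sum maps, so that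
generation can be established from a relative sum map over a ring base and its base change (§3).
[cite: Lang1983AbelianVarieties, II §3 (p. 35)] [cite: Serre1958MorphismesUniversels, no. 1 Déf. 1] -/
theorem generates_iff_exists_surjective_pmSumGrp : Generates φ ↔ ∃ n, Surjective (pmSumGrp φ n).left := by
  simp only [Generates, surjective_pmSumGrp_left_iff]

/-- **Generation is insensitive to an isomorphism of the source**: for `e : X′ ≅ X`, `e ≫ φ` generates `A`
iff `φ` does (`s_n(e ≫ φ) = (e ⊗ e)^{⊗(n+1)} ≫ s_n(φ)` with `(e ⊗ e)^{⊗(n+1)}` an isomorphism).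
[cite: Lang1983AbelianVarieties, II §3 (p. 35)] -/
theorem generates_iso_hom_comp_iff {X' : SchemeOver K} (e : X' ≅ X) : Generates (e.hom ≫ φ) ↔ Generates φ := by
  rw [generates_iff_exists_surjective_pmSumGrp, generates_iff_exists_surjective_pmSumGrp]
  refine exists_congr fun n => ?_
  haveI := isIso_pmPowObjMap e.hom n
  rw [← pmPowObjMap_comp_pmSumGrp φ e.hom n]
  exact surjective_iso_hom_comp_left_iff (asIso (pmPowObjMap e.hom n)) (pmSumGrp φ n)

end Field

end Literature.AlgebraicGeometry.Motives

end
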